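import Literature.Barriers.ValiantsHypothesis.CT23EvaluationEquationsFromEngine
import Literature.Barriers.ValiantsHypothesis.CT23SignConstSkeleton
import Literature.Barriers.ValiantsHypothesis.CT23SignConstKroneckerPowers
import Literature.Barriers.ValiantsHypothesis.CT23SuccinctDeterminant
import Literature.Barriers.ValiantsHypothesis.CT23EncoderSpecialisation
import Literature.Barriers.ValiantsHypothesis.CT23ProjCircuitBaseChange
import HarnessLib

/-!
# `CT23_lemma_4_7` holds — Chatterjee–Tengse, *Lower Bounds from Succinct Hitting Sets*
# (arXiv:2309.07612v2), Lemma 4.7 "Evaluation vectors of VP have small equations", via the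
# constant-free integer annihilator engine (val-lit cell; t18 g8, brick E-f, closer B)

Theorem-only file (no definitions, NO named facts). `CT23_lemma_4_7_of_intEngine`
(`CT23EvaluationEquationsFromEngine.lean`) reduced the named fact `CT23_lemma_4_7` to the explicit
hypothesis `IntEngine` — the integer / constant-free / input-free / multilinear output of the
annihilator engine of Thm. 3.1 (§3 of the source, "moreover, the circuit is constant-free when
`C_G` is"). This file discharges `IntEngine` (`CT23Lemma47.intEngine`) and concludes
`CT23_lemma_4_7_holds : CT23_lemma_4_7`.

The engine over `ℤ` is obtained by running the cell's bricks over `ℚ` and DESCENDING: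

1. the given constant-free `ℤ`-circuits `Q_t` (fan-in two, sign constants, input-free, common
   workspace `Fin w`) are compressed to the workspace `Fin (3s+2)` (t20 `ProjCircuit.compress`)
   and base-changed to `ℚ` (E-h `ProjCircuit.map`), still sign-constant;
2. Lemma 3.2 with explicit prefix columns at block width `δ = 1` (box side `D = 2`, p2 FILE 1):
   the count `binom(m + n'd, m) ≤ (n'd+1)^m < 2^{n'}`, the minimal dependent prefix, an INTEGER
   good `α ≤ Δ^m K²` for the Kronecker rows (E-h `exists_nat_kronecker_det_eval_ne_zero`), and the
   multilinear annihilator `A = det M̃` over `ℚ`;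
3. Lemma 3.5 in CONSTANT-FREE form ("all the three expressions described above are constant-free,
   algebraic expressions", v1 p0016.txt:L6): t20's sign-constant Kronecker powers
   `CT23Encoder.exists_signConst_kronPow` (the numerals `α^{2^l Δ^k}` built from `±1` by repeated
   squaring, `CT23SignConstKroneckerPowers.lean` + `ConstantFreeNumerals.lean`) fed to p2's
   `CT23Encoder.exists_encoderCircuit_signConst_of_kronPow` (sign-constant skeleton over an
   integer template + the generic encoder `encCircuitWith`, `CT23SignConstSkeleton.lean` /
   `CT23ExplicitAnnihilatorCircuitSignConst.lean`), then Prop. 2.29 in general form WITH its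
   printed "moreover, if `C` is constant-free then so is `C'`" (t24
   `exists_projCircuit_det_matOf_general`): a sign-constant fan-in-two projection circuit over `ℚ`
   computing `rename Sum.inl A`, of size `≤ B⁵`, `B = (n'+1)(m+1)(d+1)(s+1)` (`cE = 5`);
4. descent (E-h): a sign-constant circuit is the base change of its `ℤ`-lift
   (`ProjCircuit.exists_int_computes`), and a polynomial over `ℤ` whose image in `ℚ` is
   `rename Sum.inl A` is itself `rename Sum.inl A₀` with `A₀ ↦ A`
   (`exists_eq_rename_of_map_eq_rename`); `A₀ ≠ 0`, `A₀` multilinear, `A₀ ∘ G = 0` by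
   injectivity of `ℤ → ℚ`.

Honest framing: Lemma 4.7 is a 2023 published statement about equations for evaluation vectors
(consequences-side literature for the natural-proofs barrier programme). `VP ≠ VNP` is NOT proved
and nothing here bears on it.

## References

* [ChatterjeeTengse2023] P. Chatterjee, A. Tengse, *Lower Bounds from Succinct Hitting Sets*,
  arXiv:2309.07612v2, Lemma 4.7 and its proof, Thm. 3.1 / §3.3 "moreover … constant-free",
  Lemma 3.2, Lemma 3.5, Prop. 2.29 (v1: Lemma 50, p0017.txt:L58–L70; §3, p0014.txt:L6–L10,
  p0016.txt:L10–L27).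
-/

noncomputable section

open MvPolynomial

namespace Literature.Barriers.ValiantsHypothesis

open Literature.Computability.AlgebraicComplexity CT23Encoder

universe u

namespace CT23Lemma47

/-- `binom(m + T, T) ≤ (T+1)^m`. [folklore] -/
private theorem choose_le_succ_pow (m T : ℕ) : (m + T).choose T ≤ (T + 1) ^ m := by
  rw [show (m + T).choose T = (T + m).choose m by rw [add_comm]; exact Nat.choose_symm_add]
  exact Nat.choose_add_le_add_one_pow T m

/-- `log₂ α < 3n'` for the integer good `α ≤ Δ^m K²` of the extractor (`Δ^m = (n'd+1)^m < 2^{n'}`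
by the count, `K < 2^{n'}`). [cite: ChatterjeeTengse2023, Lemma 3.2 / Lemma 4.7 regime (v1: Lemma 39, Lemma 50)] -/
private theorem log_alpha_lt {n' m d αn K : ℕ} (hn : 2 ≤ n')
    (hα : αn ≤ (n' * (2 ^ 1 - 1) * d + 1) ^ m * K ^ 2)
    (hK : K + 1 ≤ 2 ^ (n' * 1)) (hbox : (n' * d + 1) ^ m < 2 ^ n') : Nat.log 2 αn < 3 * n' := by
  rw [show 2 ^ 1 - 1 = 1 from rfl, mul_one] at hα
  rw [mul_one] at hK
  have hK' : K ≤ 2 ^ n' := by omega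
  have h1 : αn < 2 ^ (3 * n') := by
    calc αn ≤ (n' * d + 1) ^ m * K ^ 2 := hα
      _ ≤ (n' * d + 1) ^ m * (2 ^ n') ^ 2 := by gcongr
      _ < 2 ^ n' * (2 ^ n') ^ 2 := Nat.mul_lt_mul_of_pos_right hbox (by positivity)
      _ = 2 ^ (3 * n') := by rw [← pow_mul, ← pow_add]; ring_nf
  rcases Nat.eq_zero_or_pos αn with h0 | h0
  · rw [h0, Nat.log_zero_right]; omega
  · exact Nat.log_lt_of_lt_pow h0.ne' h1

/-- `log₂ (Δ^m) < n'` and `log₂ Δ < n'` (`Δ = n'd+1`, `m ≥ 1`). [cite: ChatterjeeTengse2023, Lemma 4.7 regime (v1: Lemma 50)] -/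
private theorem log_Delta_lt {n' m d : ℕ} (hm : 1 ≤ m) (hbox : (n' * d + 1) ^ m < 2 ^ n') :
    Nat.log 2 ((n' * (2 ^ 1 - 1) * d + 1) ^ m) < n' ∧ Nat.log 2 (n' * (2 ^ 1 - 1) * d + 1) < n' := by
  rw [show 2 ^ 1 - 1 = 1 from rfl, mul_one]
  have h1 : n' * d + 1 ≤ (n' * d + 1) ^ m := by
    calc n' * d + 1 = (n' * d + 1) ^ 1 := (pow_one _).symm
      _ ≤ (n' * d + 1) ^ m := Nat.pow_le_pow_right (by omega) hm
  exact ⟨Nat.log_lt_of_lt_pow (by positivity) hbox, Nat.log_lt_of_lt_pow (by omega) (h1.trans_lt hbox)⟩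

/-- The workspace count of the `δ = 1` layout: `3n'² + 10n' + 3s + 5 ≤ B³`,
`B = (n'+1)(m+1)(d+1)(s+1)`. [cite: ChatterjeeTengse2023, §3.3 size count (v1: p0016.txt:L18–L24)] -/
private theorem workspace_le {n' m d s : ℕ} (hn : 2 ≤ n') (hm : 1 ≤ m) (hd : 1 ≤ d) (hs : 1 ≤ s) :
    n' * 1 + n' * 1 + (n' + (3 * s + 2)) +
      (3 * (n' * 1) + 3 * (n' * 1) + (n' * 1 * (3 * (n' * 1)) + n' * 1) + (2 + 1)) ≤
      ((n' + 1) * (m + 1) * (d + 1) * (s + 1)) ^ 3 := by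
  set B := (n' + 1) * (m + 1) * (d + 1) * (s + 1) with hB
  have hnB : n' + 1 ≤ B := by
    rw [hB]
    calc n' + 1 = (n' + 1) * 1 * 1 * 1 := by ring
      _ ≤ (n' + 1) * (m + 1) * (d + 1) * (s + 1) := by gcongr <;> omega
  have hsB : s + 1 ≤ B := by
    rw [hB]
    calc s + 1 = 1 * 1 * 1 * (s + 1) := by ring
      _ ≤ (n' + 1) * (m + 1) * (d + 1) * (s + 1) := by gcongr <;> omega
  have hB24 : 24 ≤ B := by
    rw [hB]
    calc 24 = 3 * 2 * 2 * 2 := by norm_num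
      _ ≤ (n' + 1) * (m + 1) * (d + 1) * (s + 1) := by gcongr <;> omega
  have htot : n' * 1 + n' * 1 + (n' + (3 * s + 2)) +
      (3 * (n' * 1) + 3 * (n' * 1) + (n' * 1 * (3 * (n' * 1)) + n' * 1) + (2 + 1)) ≤ 21 * B ^ 2 := by
    nlinarith
  calc _ ≤ 21 * B ^ 2 := htot
    _ ≤ B * B ^ 2 := by gcongr; omega
    _ = B ^ 3 := by ring

/-- The skeleton bound at block width `1`: `8n³ + 37n² + 33n + 13`.
[cite: ChatterjeeTengse2023, Lemma 3.5, size count (v1: Lemma 42; p0016.txt:L5–L8)] -/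
private theorem skelBoundPoly_one (N : ℕ) :
    skelBoundPoly N 1 = 8 * N ^ 3 + 37 * N ^ 2 + 33 * N + 13 := by
  simp only [skelBoundPoly]
  ring

/-- `16B³ + 255B² + 328B + 75 ≤ B⁵` for `B ≥ 24`. [folklore] -/
private theorem bound_B {B : ℕ} (hB24 : 24 ≤ B) :
    16 * B ^ 3 + 255 * B ^ 2 + 328 * B + 75 ≤ B ^ 5 := by
  have hBB : 24 * 24 ≤ B * B := Nat.mul_le_mul hB24 hB24
  have e1 : 16 * B ^ 3 ≤ B ^ 4 := by
    calc 16 * B ^ 3 ≤ B * B ^ 3 := Nat.mul_le_mul_right _ (by omega)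
      _ = B ^ 4 := by ring
  have e2 : 255 * B ^ 2 ≤ B ^ 4 := by
    calc 255 * B ^ 2 ≤ (24 * 24) * B ^ 2 := Nat.mul_le_mul_right _ (by norm_num)
      _ ≤ (B * B) * B ^ 2 := Nat.mul_le_mul_right _ hBB
      _ = B ^ 4 := by ring
  have e3 : 328 * B ≤ B ^ 4 := by
    calc 328 * B ≤ (24 * 24) * B := Nat.mul_le_mul_right _ (by norm_num)
      _ ≤ (B * B) * B := Nat.mul_le_mul_right _ hBB
      _ ≤ (B * B) * B * B := Nat.le_mul_of_pos_right _ (by omega)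
      _ = B ^ 4 := by ring
  have e4 : 75 ≤ B ^ 4 := by
    calc 75 ≤ 24 * 24 := by norm_num
      _ ≤ B * B := hBB
      _ = B ^ 2 := (sq B).symm
      _ ≤ B ^ 4 := Nat.pow_le_pow_right (by omega) (by norm_num)
  calc 16 * B ^ 3 + 255 * B ^ 2 + 328 * B + 75 ≤ B ^ 4 + B ^ 4 + B ^ 4 + B ^ 4 := by gcongr
    _ = 4 * B ^ 4 := by ring
    _ ≤ B * B ^ 4 := Nat.mul_le_mul_right _ (by omega)
    _ = B ^ 5 := by ring

/-- The size count at `δ = 1`: `2·|C| + O(n'²) ≤ B⁵`, `B = (n'+1)(m+1)(d+1)(s+1)`, with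
`|C| ≤ n's + m·sA + skelBoundPoly n' 1`, `sA = 6n' + 3 log₂ α + 2 log₂ Δ^m + 3`, `log₂ α < 3n'`,
`log₂ Δ^m < n'`. [cite: ChatterjeeTengse2023, §3.3 size count with Lemma 4.7 (v1: p0016.txt:L18–L24, p0017.txt:L58–L70)] -/
private theorem size_le {N m d s lα lΔ : ℕ} (hn : 2 ≤ N) (hm : 1 ≤ m) (hd : 1 ≤ d) (hs : 1 ≤ s)
    (hlα : lα < 3 * N) (hlΔ : lΔ < N) :
    2 * (N * s + m * (6 * (N * 1) + 3 * lα + 2 * lΔ + 3) + skelBoundPoly N 1) +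
      (145 * (N * 1) ^ 2 + 256 * (N * 1) + 49) ≤ ((N + 1) * (m + 1) * (d + 1) * (s + 1)) ^ 5 := by
  rw [skelBoundPoly_one, mul_one]
  obtain ⟨B, hB⟩ : ∃ B, B = (N + 1) * (m + 1) * (d + 1) * (s + 1) := ⟨_, rfl⟩
  rw [← hB]
  have hnB : N ≤ B := by
    rw [hB]
    calc N ≤ (N + 1) * 1 * 1 * 1 := by omega
      _ ≤ (N + 1) * (m + 1) * (d + 1) * (s + 1) := by gcongr <;> omega
  have hmB : m ≤ B := by
    rw [hB]
    calc m ≤ 1 * (m + 1) * 1 * 1 := by omega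
      _ ≤ (N + 1) * (m + 1) * (d + 1) * (s + 1) := by gcongr <;> omega
  have hsB : s ≤ B := by
    rw [hB]
    calc s ≤ 1 * 1 * 1 * (s + 1) := by omega
      _ ≤ (N + 1) * (m + 1) * (d + 1) * (s + 1) := by gcongr <;> omega
  have hB24 : 24 ≤ B := by
    rw [hB]
    calc 24 = 3 * 2 * 2 * 2 := by norm_num
      _ ≤ (N + 1) * (m + 1) * (d + 1) * (s + 1) := by gcongr <;> omega
  have h1 : N * s ≤ B ^ 2 := by
    calc N * s ≤ B * B := Nat.mul_le_mul hnB hsB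
      _ = B ^ 2 := (sq B).symm
  have h2 : m * (6 * N + 3 * lα + 2 * lΔ + 3) ≤ 17 * B ^ 2 + 3 * B := by
    calc m * (6 * N + 3 * lα + 2 * lΔ + 3) ≤ B * (17 * B + 3) := by
          apply Nat.mul_le_mul hmB; omega
      _ = 17 * B ^ 2 + 3 * B := by ring
  have h3 : 8 * N ^ 3 + 37 * N ^ 2 + 33 * N + 13 ≤ 8 * B ^ 3 + 37 * B ^ 2 + 33 * B + 13 := by
    gcongr
  have h4 : 145 * N ^ 2 + 256 * N + 49 ≤ 145 * B ^ 2 + 256 * B + 49 := by gcongr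
  calc 2 * (N * s + m * (6 * N + 3 * lα + 2 * lΔ + 3) + (8 * N ^ 3 + 37 * N ^ 2 + 33 * N + 13)) +
        (145 * N ^ 2 + 256 * N + 49)
      ≤ 2 * (B ^ 2 + (17 * B ^ 2 + 3 * B) + (8 * B ^ 3 + 37 * B ^ 2 + 33 * B + 13)) +
        (145 * B ^ 2 + 256 * B + 49) := by gcongr
    _ = 16 * B ^ 3 + 255 * B ^ 2 + 328 * B + 75 := by ring
    _ ≤ B ^ 5 := bound_B hB24

/-- **The integer / constant-free / input-free / multilinear annihilator engine** (`IntEngine`, the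
hypothesis of `CT23_lemma_4_7_of_intEngine`), from Thm. 3.1's construction run over `ℚ` at box
side `D = 2` with an integer good `α`, sign-constant throughout, and descended to `ℤ`.
[cite: ChatterjeeTengse2023, Thm. 3.1 with §3.3 "moreover, constant-free" and Lemma 4.7 (v1: §3, p0016.txt:L10–L27; Lemma 50, p0017.txt:L58–L70)] -/
theorem intEngine : ∃ cE : ℕ, ∀ (n' m d s w : ℕ) (G : Fin n' → MvPolynomial (Fin m) ℤ)
    (Q : Fin n' → ProjCircuit ℤ (Fin m ⊕ Fin w)),
    2 ≤ n' → 1 ≤ m → 1 ≤ d → 1 ≤ s → (∀ t, (G t).totalDegree ≤ d) →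
    (n' * d + 1) ^ m < 2 ^ n' →
    (∀ t, (Q t).IsFanInTwo ∧ (Q t).HasSignConstants ∧
      (Q t).Computes (rename Sum.inl (G t)) ∧ (Q t).size ≤ s ∧
      (Q t).projVars ⊆ Set.range Sum.inr) →
    ∃ (u : ℕ) (A : MvPolynomial (Fin n') ℤ) (Q' : ProjCircuit ℤ (Fin n' ⊕ Fin u)),
      A ≠ 0 ∧ (∀ j, A.degreeOf j ≤ 1) ∧ aeval G A = 0 ∧ Q'.IsFanInTwo ∧
        Q'.HasSignConstants ∧ Q'.Computes (rename Sum.inl A) ∧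
        u ≤ ((n' + 1) * (m + 1) * (d + 1) * (s + 1)) ^ cE ∧
        Q'.size ≤ ((n' + 1) * (m + 1) * (d + 1) * (s + 1)) ^ cE := by
  refine ⟨5, ?_⟩
  intro n' m d s w G Q hn' hm hd hs hG hbox hQ
  classical
  -- (1) compress the workspace and base-change to `ℚ`
  set φ : ℤ →+* ℚ := Int.castRingHom ℚ with hφdef
  have hφ : Function.Injective φ := φ.injective_int
  have hW : ∀ t, (Q t).touchedWork.card + 1 ≤ 3 * s + 2 := fun t => by
    have h1 := ProjCircuit.card_touchedWork_le (hQ t).1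
    have h2 := (hQ t).2.2.2.1
    omega
  set Gq : Fin n' → MvPolynomial (Fin m) ℚ := fun t => MvPolynomial.map φ (G t) with hGqdef
  have hGq : ∀ t, (Gq t).totalDegree ≤ d := fun t =>
    (Finset.sup_mono (support_map_subset _ _)).trans (hG t)
  set Qq : Fin n' → ProjCircuit ℚ (Fin m ⊕ Fin (3 * s + 2)) :=
    fun t => ((Q t).compress (hW t)).map φ with hQqdef
  have hQq2 : ∀ t, (Qq t).IsFanInTwo := fun t =>
    ProjCircuit.isFanInTwo_map _ (ProjCircuit.isFanInTwo_compress (Q t) (hW t) (hQ t).1)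
  have hQqsc : ∀ t, (Qq t).HasSignConstants := fun t =>
    ProjCircuit.hasSignConstants_map φ (ProjCircuit.hasSignConstants_compress (Q t) (hW t) (hQ t).2.1)
  have hQqc : ∀ t, (Qq t).Computes (rename Sum.inl (Gq t)) := fun t => by
    have h := ProjCircuit.computes_map φ
      (ProjCircuit.eval_compress (Q t) (hW t) (G t) (hQ t).2.2.1 :
        ((Q t).compress (hW t)).Computes (rename Sum.inl (G t)))
    rwa [map_rename] at h
  have hQqs : ∀ t, (Qq t).size ≤ s := fun t => by
    change (((Q t).compress (hW t)).map φ).size ≤ s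
    rw [ProjCircuit.size_map, ProjCircuit.size_compress]
    exact (hQ t).2.2.2.1
  have hQqp : ∀ t, (Qq t).projVars ⊆ Set.range Sum.inr := fun t => by
    change (((Q t).compress (hW t)).map φ).projVars ⊆ _
    rw [ProjCircuit.projVars_map]
    exact ProjCircuit.projVars_compress_subset (Q t) (hW t) (hQ t).2.2.2.2
  -- (2) Lemma 3.2 with prefix columns at block width `δ = 1`
  have hcount : (m + n' * (2 ^ 1 - 1) * d).choose (n' * (2 ^ 1 - 1) * d) < 2 ^ (n' * 1) := by
    rw [show 2 ^ 1 - 1 = 1 from rfl, mul_one]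
    exact (choose_le_succ_pow m (n' * d)).trans_lt hbox
  have hdep := not_linearIndependent_blockEnum Gq hGq hcount
  have hK : prefixLen Gq (blockEnum n' 1) hdep + 1 ≤ 2 ^ (n' * 1) := prefixLen_succ_le _ _ _
  obtain ⟨αn, hαle, hαdet⟩ := exists_nat_kronecker_det_eval_ne_zero (n' * (2 ^ 1 - 1) * d + 1)
    (linearIndependent_prefix Gq (blockEnum n' 1) hdep)
    (fun j c hc b => box_blockEnum Gq hGq _ c hc b)
  have hα : (kronMinor Gq (blockEnum n' 1) hdep (n' * (2 ^ 1 - 1) * d + 1) (αn : ℚ)).det ≠ 0 := by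
    simpa [kronMinor] using hαdet
  set A : MvPolynomial (Fin n') ℚ :=
    (prefixAnnMatrix Gq (blockEnum n' 1) hdep (n' * (2 ^ 1 - 1) * d + 1) (αn : ℚ)).det with hAdef
  have hA0 : A ≠ 0 := det_prefixAnnMatrix_ne_zero Gq _ (blockEnum_injective _ _) hdep _ hα
  have hAdeg : ∀ t, A.degreeOf t < 2 ^ 1 := fun t =>
    degreeOf_det_prefixAnnMatrix_lt Gq _ hdep (by norm_num) (fun j t => blockEnum_lt _ _ j t) _ _ t
  have hAG : aeval Gq A = 0 := aeval_det_prefixAnnMatrix Gq _ hdep _ _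
  -- (3) ONE layout of all the variable blocks in the workspace `Fin u`
  let Ω : Type :=
    ((Fin (n' * 1) ⊕ Fin (n' * 1)) ⊕ (Fin n' ⊕ Fin (3 * s + 2))) ⊕
      (((Fin (3 * (n' * 1)) ⊕ Fin (3 * (n' * 1))) ⊕
          ((Fin (n' * 1) × Fin (3 * (n' * 1))) ⊕ Fin (n' * 1))) ⊕ (Bool ⊕ Unit))
  let eΩ : Ω ≃ Fin (Fintype.card Ω) := Fintype.equivFin Ω
  let emb : Ω → Fin n' ⊕ Fin (Fintype.card Ω) := fun o => Sum.inr (eΩ o)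
  have hemb : Function.Injective emb := fun o o' h => eΩ.injective (Sum.inr_injective h)
  let x : Fin n' → Fin n' ⊕ Fin (Fintype.card Ω) := Sum.inl
  let a : Fin (n' * 1) → Fin n' ⊕ Fin (Fintype.card Ω) := fun l => emb (Sum.inl (Sum.inl (Sum.inl l)))
  let b : Fin (n' * 1) → Fin n' ⊕ Fin (Fintype.card Ω) := fun l => emb (Sum.inl (Sum.inl (Sum.inr l)))
  let p : Fin n' → Fin n' ⊕ Fin (Fintype.card Ω) := fun t => emb (Sum.inl (Sum.inr (Sum.inl t)))
  let ws : Fin (3 * s + 2) → Fin n' ⊕ Fin (Fintype.card Ω) :=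
    fun j => emb (Sum.inl (Sum.inr (Sum.inr j)))
  let Ul : Fin (3 * (n' * 1)) → Fin n' ⊕ Fin (Fintype.card Ω) :=
    fun l => emb (Sum.inr (Sum.inl (Sum.inl (Sum.inl l))))
  let Vl : Fin (3 * (n' * 1)) → Fin n' ⊕ Fin (Fintype.card Ω) :=
    fun l => emb (Sum.inr (Sum.inl (Sum.inl (Sum.inr l))))
  let wsq : Fin (n' * 1) → Fin (3 * (n' * 1)) → Fin n' ⊕ Fin (Fintype.card Ω) :=
    fun i l => emb (Sum.inr (Sum.inl (Sum.inr (Sum.inl (i, l)))))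
  let zsq : Fin (n' * 1) → Fin n' ⊕ Fin (Fintype.card Ω) :=
    fun i => emb (Sum.inr (Sum.inl (Sum.inr (Sum.inr i))))
  let μ₁ : Fin n' ⊕ Fin (Fintype.card Ω) := emb (Sum.inr (Sum.inr (Sum.inl true)))
  let μ₂ : Fin n' ⊕ Fin (Fintype.card Ω) := emb (Sum.inr (Sum.inr (Sum.inl false)))
  let dflt : Fin n' ⊕ Fin (Fintype.card Ω) := emb (Sum.inr (Sum.inr (Sum.inr ())))
  have hx : Function.Injective x := Sum.inl_injective
  have lay : CircLayout x a b p ws := by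
    refine ⟨?_⟩
    let ψ : (Fin (n' * 1) ⊕ Fin (n' * 1)) ⊕ (Fin n' ⊕ Fin (3 * s + 2)) → Ω := fun o => Sum.inl o
    have hψ : Function.Injective ψ := fun o o' h => Sum.inl_injective h
    have key : Sum.elim (Sum.elim x (Sum.elim a b)) (Sum.elim p ws) =
        Sum.elim (Sum.elim x (emb ∘ ψ ∘ Sum.inl)) (emb ∘ ψ ∘ Sum.inr) := by
      funext o; rcases o with (t | (l | l)) | (t | j) <;> rfl
    rw [key]
    refine Function.Injective.sumElim (Function.Injective.sumElim hx
      (hemb.comp (hψ.comp Sum.inl_injective)) (fun t o h => Sum.inl_ne_inr h))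
      (hemb.comp (hψ.comp Sum.inr_injective)) ?_
    rintro (t | o) o' h
    · exact Sum.inl_ne_inr h
    · have := hψ (hemb h); simp at this
  have Dsup : DetSupply a b Ul Vl wsq zsq μ₁ μ₂ := by
    refine ⟨?_⟩
    let ψ : ((Fin (n' * 1) ⊕ Fin (n' * 1)) ⊕ (Fin (3 * (n' * 1)) ⊕ Fin (3 * (n' * 1)))) ⊕
        (((Fin (n' * 1) × Fin (3 * (n' * 1))) ⊕ Fin (n' * 1)) ⊕ Bool) → Ω :=
      Sum.elim (Sum.elim (fun ab => Sum.inl (Sum.inl ab)) (fun uv => Sum.inr (Sum.inl (Sum.inl uv))))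
        (Sum.elim (fun wz => Sum.inr (Sum.inl (Sum.inr wz))) (fun bb => Sum.inr (Sum.inr (Sum.inl bb))))
    have hψ : Function.Injective ψ := by
      rintro ((ab | uv) | (wz | bb)) ((ab' | uv') | (wz' | bb')) h <;>
        simp only [ψ, Ω, Sum.elim_inl, Sum.elim_inr, Sum.inl.injEq, Sum.inr.injEq,
          reduceCtorEq] at h <;> rw [h]
    have key : Sum.elim (Sum.elim (Sum.elim a b) (Sum.elim Ul Vl))
        (Sum.elim (Sum.elim (fun q : Fin (n' * 1) × Fin (3 * (n' * 1)) => wsq q.1 q.2) zsq)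
          (fun bb : Bool => if bb then μ₁ else μ₂)) = emb ∘ ψ := by
      funext o
      rcases o with ((l | l) | (l | l)) | ((⟨i, l⟩ | i) | bb)
      all_goals first | rfl | (cases bb <;> rfl)
    rw [key]
    exact hemb.comp hψ
  -- (4) the SIGN-CONSTANT explicit encoder circuit of the padded `M̃` (Lemma 3.5, integer `α`):
  -- t20's constant-free Kronecker powers fed to p2's FILE 5 (constant-free skeleton + FILE 4)
  obtain ⟨C, hC2, hCsc, hCcomp, hCsz, hCproj⟩ :=
    CT23Encoder.exists_encoderCircuit_signConst_of_kronPow lay dflt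
      (natBits _ (prefixLen Gq (blockEnum n' 1) hdep) (Nat.lt_of_succ_le hK))
      (αn : ℚ) (n' * (2 ^ 1 - 1) * d + 1) Gq Qq hQq2 hQqc hQqs hQqp hQqsc
      (fun k => CT23Encoder.exists_signConst_kronPow (m := m) a αn (n' * (2 ^ 1 - 1) * d + 1) k)
  have hdetE := CT23Encoder.det_matOf_encoderSkeleton_prefix lay.toEncLayout Gq hdep (αn : ℚ)
    (n' * (2 ^ 1 - 1) * d + 1)
  -- the encoder polynomial mentions only `x`, `a`, `b`
  have hEvars : ∀ v ∈ (encoderSkeleton x a b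
      (natBits _ (prefixLen Gq (blockEnum n' 1) hdep) (Nat.lt_of_succ_le hK))
      (fun t => gKron a (αn : ℚ) (n' * (2 ^ 1 - 1) * d + 1) (Gq t))).vars,
      v ∈ Set.range x ∪ Set.range a ∪ Set.range b := fun v hv =>
    vars_encoderSkeleton_gKron_subset x a b _ (αn : ℚ) _ Gq (Finset.mem_coe.2 hv)
  have hEU : ∀ v ∈ (encoderSkeleton x a b
      (natBits _ (prefixLen Gq (blockEnum n' 1) hdep) (Nat.lt_of_succ_le hK))
      (fun t => gKron a (αn : ℚ) (n' * (2 ^ 1 - 1) * d + 1) (Gq t))).vars,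
      (∀ l, Ul l ≠ v) ∧ ∀ l, Vl l ≠ v := by
    intro v hv
    rcases hEvars v hv with (⟨t, rfl⟩ | ⟨l', rfl⟩) | ⟨l', rfl⟩
    · exact ⟨fun l h => Sum.inr_ne_inl h, fun l h => Sum.inr_ne_inl h⟩
    · exact ⟨fun l h => by have := hemb h; simp [Ω] at this,
        fun l h => by have := hemb h; simp [Ω] at this⟩
    · exact ⟨fun l h => by have := hemb h; simp [Ω] at this,
        fun l h => by have := hemb h; simp [Ω] at this⟩
  have hEw : ∀ i l, wsq i l ∉ (encoderSkeleton x a b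
      (natBits _ (prefixLen Gq (blockEnum n' 1) hdep) (Nat.lt_of_succ_le hK))
      (fun t => gKron a (αn : ℚ) (n' * (2 ^ 1 - 1) * d + 1) (Gq t))).vars := by
    intro i l hv
    rcases hEvars _ hv with (⟨t, h⟩ | ⟨l', h⟩) | ⟨l', h⟩
    · exact Sum.inl_ne_inr h
    · have := hemb h; simp [Ω] at this
    · have := hemb h; simp [Ω] at this
  have hEz : ∀ i, zsq i ∉ (encoderSkeleton x a b
      (natBits _ (prefixLen Gq (blockEnum n' 1) hdep) (Nat.lt_of_succ_le hK))
      (fun t => gKron a (αn : ℚ) (n' * (2 ^ 1 - 1) * d + 1) (Gq t))).vars := by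
    intro i hv
    rcases hEvars _ hv with (⟨t, h⟩ | ⟨l', h⟩) | ⟨l', h⟩
    · exact Sum.inl_ne_inr h
    · have := hemb h; simp [Ω] at this
    · have := hemb h; simp [Ω] at this
  have hCpv : ∀ i ∈ C.projVars, (∀ l, a l ≠ i) ∧ (∀ l, b l ≠ i) ∧ (∀ l, Ul l ≠ i) ∧ (∀ l, Vl l ≠ i) ∧
      (∀ j l, wsq j l ≠ i) ∧ ∀ j, zsq j ≠ i := by
    intro i hi
    obtain ⟨j, rfl⟩ := hCproj hi
    refine ⟨fun l h => ?_, fun l h => ?_, fun l h => ?_, fun l h => ?_, fun j' l h => ?_, fun j' h => ?_⟩ <;>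
      · have := hemb h; simp [Ω] at this
  -- (5) Prop. 2.29 (general form + "moreover"): the determinant, sign-constant
  have hL : 0 < n' * 1 := by omega
  obtain ⟨Qd, hQd2, hQdsc, hQdcomp, hQdsz, -⟩ :=
    exists_projCircuit_det_matOf_general hL le_rfl Dsup hEU hEw hEz hC2 hCcomp hCpv
  have hQdsc' : Qd.HasSignConstants := hQdsc hCsc
  have hQdev : Qd.eval = rename Sum.inl A := by
    have h : Qd.eval = _ := hQdcomp
    rw [h, hdetE]
  -- (6) descent to `ℤ`
  obtain ⟨P₀, hP₀2, hP₀sc, hP₀map, hP₀size, -⟩ := ProjCircuit.exists_int_computes hQdsc' hQd2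
  obtain ⟨A₀, hP₀ev, hA₀⟩ :=
    exists_eq_rename_of_map_eq_rename hφ P₀.eval A (by rw [hP₀map, hQdev])
  -- (7) conclusion
  refine ⟨Fintype.card Ω, A₀, P₀, ?_, ?_, ?_, hP₀2, hP₀sc, hP₀ev, ?_, ?_⟩
  · intro h
    apply hA0
    rw [← hA₀, h, map_zero]
  · intro j
    have h := hAdeg j
    rw [← hA₀, degreeOf_eq_sup, support_map_of_injective _ hφ, ← degreeOf_eq_sup] at h
    have : (2 : ℕ) ^ 1 = 2 := rfl
    omega
  · apply map_injective φ hφ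
    rw [map_zero, aeval_eq_bind₁, map_bind₁, ← aeval_eq_bind₁, hA₀]
    exact hAG
  · have hcard : Fintype.card Ω = n' * 1 + n' * 1 + (n' + (3 * s + 2)) +
        (3 * (n' * 1) + 3 * (n' * 1) + (n' * 1 * (3 * (n' * 1)) + n' * 1) + (2 + 1)) := by
      simp only [Ω, Fintype.card_sum, Fintype.card_prod, Fintype.card_fin, Fintype.card_bool,
        Fintype.card_unit]
    rw [hcard]
    exact (workspace_le hn' hm hd hs).trans (Nat.pow_le_pow_right (by positivity) (by norm_num))
  · rw [hP₀size]
    refine hQdsz.trans ((Nat.add_le_add_right (Nat.mul_le_mul_left 2 hCsz) _).trans ?_)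
    exact size_le hn' hm hd hs (log_alpha_lt hn' hαle hK hbox) (log_Delta_lt hm hbox).1

end CT23Lemma47

/-- **Chatterjee–Tengse Lemma 4.7 holds** (discharge of the named fact `CT23_lemma_4_7`): the
integer annihilator engine `CT23Lemma47.intEngine` fed to `CT23_lemma_4_7_of_intEngine`.
[cite: ChatterjeeTengse2023, Lemma 4.7 and its proof (v1: Lemma 50; p0017.txt:L58–L70)] -/
theorem CT23_lemma_4_7_holds : CT23_lemma_4_7 :=
  CT23_lemma_4_7_of_intEngine CT23Lemma47.intEngine

end Literature.Barriers.ValiantsHypothesis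

end
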